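import Literature.NumberTheory.DiophantineGeometry.DenesEquationFreyCurveProofs
import Literature.NumberTheory.DiophantineGeometry.GeneralizedFermatTwoPowerCoefficientFreyProofs
import Literature.NumberTheory.DiophantineGeometry.GeneralizedFermatTwoPowerCoefficientFreyTwoProofs
import Literature.NumberTheory.DiophantineGeometry.LocalReductionIsSemistableProofs
import HarnessLib

/-!
# The Frey curve of Dénes' equation at `2` when `abc` is odd: Tate's algorithm gives type `III`,
# `f₂ = 5`, `N = 2⁵ rad(abc)` (Darmon–Merel 1997, Prop. 1.1 (1), second case) — proofs

Topic `Literature/NumberTheory/DiophantineGeometry`; namespace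
`Literature.NumberTheory.DiophantineGeometry`. Sibling *proofs* file (theorems only: no definition,
no named fact, no `sorry`) of `DenesEquationFreyCurveProofs`, for the named fact
`Literature.NumberTheory.DiophantineGeometry.darmonMerel1997_denesEquation`. Source: H. Darmon,
L. Merel, *Winding quotients and some variants of Fermat's Last Theorem*, J. reine angew. Math.
490 (1997), 81–100, §1, Proposition 1.1 (p. 6 of the authors' 26-page version):

> *Proposition 1.1. Let `N` be the arithmetic conductor of the curve `E` constructed above.
> 1. For equation (1), `N = rad(abc)` if `abc` is even, and `N = 2⁵ rad(abc)` if `abc` is odd. …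
> Sketch of Proof: The bad reduction types of the curve `E`, and the arithmetic conductor `N` of
> `E`, can be computed using Tate's algorithm [28]. (We also used the results of [9] in the case of
> equations (1) to analyze the bad fiber at `2` of `E`.)*

(`[9]` = Diamond–Kramer, `[28]` = Tate.) Here `E : Y² = X(X − aᵖ)(X − 2cᵖ)` is the curve (4) of a
primitive solution of `aᵖ + bᵖ = 2cᵖ`, in the tree `freyCurve (a ^ p) (-(2 * c ^ p))`
(`y² = x(x − A)(x + B)`, `A = aᵖ`, `B = −2cᵖ`). `DenesEquationFreyCurveProofs` proved the first
case (`abc` even: `N = rad(abc)`, semistable) and the odd part of `N` in general; this file runs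
the tree's Tate algorithm (`DiophantineGeometry/TateAlgorithm*`, Silverman *ATAEC* IV.9.4) at `2`
in the **second case** and completes Prop. 1.1 (1):

* `kodairaSymbolAt_freyCurve_two_of_two_dvd` — for the general Frey–Hellegouarch curve
  `y² = x(x − A)(x + B)` with `A` odd and `2 ∥ B` (the row `ord₂(B) = 1`, `t = 5` of
  Diamond–Kramer as quoted by Ribet 1997, §2, p. 11: "`t` is `5, 3, 3, 0` or `1` according as
  `ord₂(B)` is `1, 2, 3, 4`, or an integer greater than `4`"; the rows `2, 3` are the sibling
  `GeneralizedFermatTwoPowerCoefficientFreyTwoProofs`, the rows `≥ 4`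
  `GeneralizedFermatTwoPowerCoefficientFreyProofs`): at the place above `2`, Kodaira type `III`,
  `ord₂(Δ_min) = 6`, `f₂ = 6 + 1 − 2 = 5`. Tate's algorithm on the integral equation
  `y² = x³ + (B − A)x² − ABx` (minimal: `ord₂ Δ = 6 < 12`): the reduction `y² = x²(x + 1)` is
  singular at `(0, 0)` (`π ∣ a₃ = 0, a₄ = −AB, a₆ = 0`), `π ∣ b₂ = 4(B − A)` (Step 2 fails),
  `π² ∣ a₆ = 0` (Step 3 fails), `π³ ∤ b₈ = −(AB)²` as `ord₂(AB) = 1` (Step 4 fires: type `III`);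
  `kodairaSymbolOfMinimal_eq_III_of_step2` (`TateAlgorithmEvalProofs`).
* `kodairaSymbolAt_freyCurve_denes_two`, `conductorExponent_freyCurve_denes_two` — the curve (4)
  of a solution with `a`, `c` odd: type `III` at `2`, `f₂ = 5`;
  `hasAdditiveReductionAt_freyCurve_denes_two`, `not_isSemistable_freyCurve_denes_of_odd` — it has
  additive reduction at `2`, so is **not semistable** when `abc` is odd (whence Darmon–Merel's
  appeal, Thm. 1.3, p. 7, to "Diamond's extension [8] of the work of Wiles [30] and Taylor–Wiles
  [29]": "The curve associated to a solution of equation (1) or (2) is semistable at `3` and `5`").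
* `conductorNorm_freyCurve_denes_of_odd` — **Prop. 1.1 (1), second case: `N = 2⁵ rad(abc)` if
  `abc` is odd** (no sign normalisation needed in this case), and `conductorNorm_freyCurve_denes`
  — **Prop. 1.1 (1) complete** for a solution normalised by `a ≡ −1 (mod 4)`:
  `N = rad(abc)` if `2 ∣ c` and `N = 2⁵ rad(abc)` otherwise (`a, b` being odd, `abc` is even iff
  `c` is).

## References

* H. Darmon, L. Merel, *Winding quotients and some variants of Fermat's Last Theorem*, J. reine
  angew. Math. 490 (1997), 81–100, §1, Prop. 1.1 and Thm. 1.3. [DarmonMerel1997]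
* F. Diamond, K. Kramer, *Modularity of a family of elliptic curves*, Math. Res. Lett. 2 (1995),
  299–304 (reference [9] of Darmon–Merel). [DiamondKramer1995]
* K. A. Ribet, *On the equation `a^p + 2^α b^p + c^p = 0`*, Acta Arith. 79 (1997), §2, p. 11.
  [Ribet1997]
* J. H. Silverman, *Advanced Topics in the Arithmetic of Elliptic Curves*, GTM 151, IV.9.4
  (Tate's algorithm, Steps 1–4), Table 4.1, IV.11.1 (Ogg's formula). [SilvermanATAEC1994]
-/

noncomputable section

open IsDedekindDomain WeierstrassCurve Rat.HeightOneSpectrum IsLocalRing UniqueFactorizationMonoid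
open IsDiscreteValuationRing hiding maximalIdeal
open Literature.NumberTheory.DiophantineGeometry.TateAlgorithm Literature.NumberTheory.EllipticCurves

namespace Literature.NumberTheory.DiophantineGeometry

/-! ### The general Frey curve with `A` odd, `2 ∥ B`: type `III`, `ord₂ Δ_min = 6`, `f₂ = 5` -/

section General

variable {A B : ℤ} (v : HeightOneSpectrum ℤ)

/-- **The Frey curve `y² = x(x − A)(x + B)` with `A` odd and `2 ∥ B`, at `2`: Kodaira type `III`,
`ord₂(Δ_min) = 6`, conductor exponent `f₂ = 6 + 1 − 2 = 5`** (the row `ord₂(B) = 1`, `t = 5` of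
Diamond–Kramer 1995 as quoted in Ribet 1997, §2, p. 11; Darmon–Merel 1997, Prop. 1.1 (1):
"`N = 2⁵ rad(abc)` if `abc` is odd"). Tate's algorithm (Silverman *ATAEC* IV.9.4, Steps 1–4) on
the integral equation `y² = x³ + (B − A)x² − ABx`, which is minimal at `2` (`ord₂ Δ = 6`): the
singular point of the reduction `y² = x²(x + 1)` is `(0, 0)` (`π ∣ a₃, a₄, a₆`), `π ∣ b₂ =
4(B − A)`, `π² ∣ a₆ = 0`, and `π³ ∤ b₈ = −(AB)²` since `ord₂(AB) = 1`, so Step 4 returns type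
`III` (`kodairaSymbolOfMinimal_eq_III_of_step2`). [cite: DarmonMerel1997, Prop. 1.1 (1)]
[cite: Ribet1997, §2, p. 11] [cite: SilvermanATAEC1994, IV.9.4 Steps 1–4 and Table 4.1] -/
theorem kodairaSymbolAt_freyCurve_two_of_two_dvd (hv : natGenerator v = 2)
    (h0 : A * B * (A + B) ≠ 0) (hA : ¬ (2 : ℤ) ∣ A) {b : ℤ} (hB : B = 2 * b) (hb : ¬ (2 : ℤ) ∣ b) :
    (freyCurve A B).kodairaSymbolAt v = .III ∧ (freyCurve A B).ordMinimalDiscriminant v = 6 ∧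
      (freyCurve A B).conductorExponent v = 5 := by
  haveI := isElliptic_freyCurve h0
  haveI hI := isIntegral_baseChange_freyCurve (A := A) (B := B) v
  have hAB : ¬ (2 : ℤ) ∣ A + B := by
    rw [hB]; intro h; apply hA
    have : A = (A + 2 * b) - 2 * b := by ring
    rw [this]; exact dvd_sub h (dvd_mul_right 2 _)
  have hB' : B = 2 ^ 1 * b := by rw [hB]; ring
  haveI hmin : ((freyCurve A B).baseChange (v.adicCompletion ℚ)).IsMinimal
      (v.adicCompletionIntegers ℚ) :=
    isMinimalAt_freyCurve_two v hv (by norm_num) hB' hb hA hAB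
  have hΔ : ((freyCurve A B).baseChange (v.adicCompletion ℚ)).Δ ≠ 0 := by
    haveI : ((freyCurve A B).baseChange (v.adicCompletion ℚ)).IsElliptic := by
      rw [WeierstrassCurve.baseChange]; infer_instance
    exact ((freyCurve A B).baseChange (v.adicCompletion ℚ)).isUnit_Δ.ne_zero
  have hrel : (freyCurve A B).baseChange (v.adicCompletion ℚ) =
      (1 : VariableChange (v.adicCompletion ℚ)) • (freyCurve A B).baseChange (v.adicCompletion ℚ) :=
    (one_smul _ _).symm
  have hIM := integralModel_baseChange_freyCurve (A := A) (B := B) v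
  set W₀ := (freyIntModel A B).map (algebraMap ℤ (v.adicCompletionIntegers ℚ)) with hW₀
  obtain ⟨hb₂, -, hb₈⟩ := freyIntModel_b A B
  -- Steps 1–4 of Tate's algorithm on the integral model itself (no change of coordinates)
  have hK0 : W₀.kodairaSymbolOfMinimal = .III := by
    refine kodairaSymbolOfMinimal_eq_III_of_step2 ?_ ?_ ?_ ?_ ?_ ?_ ?_
    · -- `π ∣ Δ = 16 (AB(A+B))²`
      rw [hW₀, map_Δ, freyIntModel_Δ, eq_intCast]
      have h1 := uniformizer_pow_dvd_intCast v hv (k := 1) (n := 16 * (A * B * (A + B)) ^ 2)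
        ⟨8 * (A * B * (A + B)) ^ 2, by ring⟩
      rwa [pow_one] at h1
    · simp only [hW₀, map_a₃, freyIntModel, eq_intCast, Int.cast_zero]; exact dvd_zero _
    · -- `π ∣ a₄ = −AB`
      simp only [hW₀, map_a₄, freyIntModel, eq_intCast]
      have h1 := uniformizer_pow_dvd_intCast v hv (k := 1) (n := -(A * B))
        ⟨-(A * b), by rw [hB]; ring⟩
      rwa [pow_one] at h1
    · simp only [hW₀, map_a₆, freyIntModel, eq_intCast, Int.cast_zero]; exact dvd_zero _
    · -- `π ∣ b₂ = 4 (B − A)`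
      rw [hW₀, map_b₂, hb₂, eq_intCast]
      have h1 := uniformizer_pow_dvd_intCast v hv (k := 1) (n := 4 * (B - A))
        ⟨2 * (B - A), by ring⟩
      rwa [pow_one] at h1
    · simp only [hW₀, map_a₆, freyIntModel, eq_intCast, Int.cast_zero]; exact dvd_zero _
    · -- `π³ ∤ b₈ = −(AB)² = 2² · (−(Ab)²)` with `Ab` odd
      rw [hW₀, map_b₈, hb₈, eq_intCast]
      refine not_uniformizer_pow_succ_dvd_intCast v hv (k := 2) (m := -(A * b) ^ 2)
        (by rw [hB]; ring) ?_
      rw [dvd_neg]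
      intro h
      rcases Int.prime_two.dvd_or_dvd (Int.prime_two.dvd_of_dvd_pow h) with h | h
      · exact hA h
      · exact hb h
  have hK : (freyCurve A B).kodairaSymbolAt v = .III := by
    rw [kodairaSymbolAt_eq_kodairaSymbolOfMinimal_of_isMinimal v (freyCurve A B) _ 1 hrel hΔ, hIM,
      hK0]
  have hord : (freyCurve A B).ordMinimalDiscriminant v = 6 := by
    rw [ordMinimalDiscriminant_eq_of_isMinimal v (freyCurve A B) _ 1 hrel hΔ, hIM,
      addVal_Δ_freyIntModel_map_toNat v hv hB' hb hA hAB]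
  refine ⟨hK, hord, ?_⟩
  show (freyCurve A B).ordMinimalDiscriminant v + 1 - (freyCurve A B).numComponentsAt v = 5
  rw [numComponentsAt, hK, hord]
  rfl

/-- `f₂ = 5` for `y² = x(x − A)(x + B)` with `A` odd, `2 ∥ B` (the conductor-exponent component of
`kodairaSymbolAt_freyCurve_two_of_two_dvd`). [cite: DarmonMerel1997, Prop. 1.1 (1)] -/
theorem conductorExponent_freyCurve_two_of_two_dvd (hv : natGenerator v = 2)
    (h0 : A * B * (A + B) ≠ 0) (hA : ¬ (2 : ℤ) ∣ A) {b : ℤ} (hB : B = 2 * b) (hb : ¬ (2 : ℤ) ∣ b) :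
    (freyCurve A B).conductorExponent v = 5 :=
  (kodairaSymbolAt_freyCurve_two_of_two_dvd v hv h0 hA hB hb).2.2

end General

/-! ### The curve (4) of Darmon–Merel when `abc` is odd -/

section Denes

variable {a b c : ℤ} {p : ℕ}

/-- An odd integer is not divisible by `2`. [folklore] -/
private theorem not_two_dvd_of_odd {n : ℤ} (hn : Odd n) : ¬ (2 : ℤ) ∣ n :=
  fun h ↦ (Int.not_even_iff_odd.mpr hn) (even_iff_two_dvd.mpr h)

/-- **Darmon–Merel 1997, Prop. 1.1 (1), the bad fibre at `2` when `abc` is odd**: for a solution of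
`aᵖ + bᵖ = 2cᵖ` with `abc ≠ 0` and `a`, `c` odd, the Frey curve `Y² = X(X − aᵖ)(X − 2cᵖ)` has
Kodaira type `III` at `2`, `ord₂(Δ_min) = 6` and `f₂ = 5` ("`N = 2⁵ rad(abc)` if `abc` is odd …
We also used the results of [9]" — Diamond–Kramer — "to analyze the bad fiber at `2` of `E`").
Instance of `kodairaSymbolAt_freyCurve_two_of_two_dvd` with `A = aᵖ` odd, `B = −2cᵖ = 2(−cᵖ)`.
[cite: DarmonMerel1997, Prop. 1.1 (1)] -/
theorem kodairaSymbolAt_freyCurve_denes_two (h : a ^ p + b ^ p = 2 * c ^ p) (h0 : a * b * c ≠ 0)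
    (ha : Odd a) (hc : Odd c) (v : HeightOneSpectrum ℤ) (hv : natGenerator v = 2) :
    (freyCurve (a ^ p) (-(2 * c ^ p))).kodairaSymbolAt v = .III ∧
      (freyCurve (a ^ p) (-(2 * c ^ p))).ordMinimalDiscriminant v = 6 ∧
        (freyCurve (a ^ p) (-(2 * c ^ p))).conductorExponent v = 5 :=
  kodairaSymbolAt_freyCurve_two_of_two_dvd v hv (denes_frey_ne_zero h h0) (not_two_dvd_of_odd ha.pow)
    (b := -c ^ p) (by ring) (not_two_dvd_of_odd hc.pow.neg)

/-- `f₂ = 5` for the Frey curve of a solution of `aᵖ + bᵖ = 2cᵖ` with `a`, `c` odd.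
[cite: DarmonMerel1997, Prop. 1.1 (1)] -/
theorem conductorExponent_freyCurve_denes_two (h : a ^ p + b ^ p = 2 * c ^ p) (h0 : a * b * c ≠ 0)
    (ha : Odd a) (hc : Odd c) (v : HeightOneSpectrum ℤ) (hv : natGenerator v = 2) :
    (freyCurve (a ^ p) (-(2 * c ^ p))).conductorExponent v = 5 :=
  (kodairaSymbolAt_freyCurve_denes_two h h0 ha hc v hv).2.2

/-- When `a`, `c` are odd the Frey curve `Y² = X(X − aᵖ)(X − 2cᵖ)` has **additive reduction at
`2`** (type `III`; directly: the integral equation is minimal at `2` with `2 ∣ Δ` and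
`2 ∣ c₄ = 16(A² + AB + B²)`, `hasAdditiveReductionAt_freyCurve_two`).
[cite: DarmonMerel1997, Prop. 1.1 (1)] -/
theorem hasAdditiveReductionAt_freyCurve_denes_two (h : a ^ p + b ^ p = 2 * c ^ p)
    (h0 : a * b * c ≠ 0) (ha : Odd a) (hc : Odd c) (v : HeightOneSpectrum ℤ)
    (hv : natGenerator v = 2) :
    (freyCurve (a ^ p) (-(2 * c ^ p))).HasAdditiveReductionAt v := by
  refine (hasAdditiveReductionAt_freyCurve_two (denes_frey_ne_zero h h0) ha.pow
    ⟨-c ^ p, by ring⟩ ?_ v hv).1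
  -- `16 ∤ −2cᵖ` for `c` odd
  intro h16
  have h2 : (2 : ℤ) * 2 ∣ 2 * c ^ p := by
    rw [← dvd_neg]; exact (show (2 : ℤ) * 2 ∣ 16 by norm_num).trans h16
  exact not_two_dvd_of_odd hc.pow ((mul_dvd_mul_iff_left two_ne_zero).mp h2)

/-- **The Frey curve of a solution with `abc` odd is not semistable** (additive at `2`) — the
reason why Darmon–Merel, Thm. 1.3 (p. 7), invoke "Diamond's extension [8] of the work of Wiles
[30] and Taylor–Wiles [29]" ("The curve associated to a solution of equation (1) or (2) is
semistable at `3` and `5`") rather than the semistable modularity theorem alone. Contrast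
`isSemistable_freyCurve_denes_of_even` (`abc` even: semistable).
[cite: DarmonMerel1997, Prop. 1.1 (1) and Thm. 1.3] -/
theorem not_isSemistable_freyCurve_denes_of_odd (h : a ^ p + b ^ p = 2 * c ^ p)
    (h0 : a * b * c ≠ 0) (ha : Odd a) (hc : Odd c) :
    ¬ (freyCurve (a ^ p) (-(2 * c ^ p))).IsSemistable ℤ := by
  obtain ⟨v, hv⟩ := exists_place ⟨2, Nat.prime_two⟩
  exact (hasAdditiveReductionAt_freyCurve_denes_two h h0 ha hc v hv).not_isSemistable

/-- In a solution of `aᵖ + bᵖ = 2cᵖ` (`p ≥ 1`) with `a` odd, `b` is odd too. [folklore] -/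
theorem odd_b_of_denes (hp : 1 ≤ p) (h : a ^ p + b ^ p = 2 * c ^ p) (ha : Odd a) : Odd b := by
  have hbp : Odd (b ^ p) := by
    rw [show b ^ p = 2 * c ^ p - a ^ p by linear_combination h]
    exact (even_two_mul _).sub_odd ha.pow
  by_contra hb
  rw [Int.not_odd_iff_even] at hb
  exact (Int.not_even_iff_odd.mpr hbp) (hb.pow_of_ne_zero (by omega))

/-- **Darmon–Merel 1997, Prop. 1.1 (1), second case: "`N = 2⁵ rad(abc)` if `abc` is odd."** For a
solution of `aᵖ + bᵖ = 2cᵖ` (`p ≥ 1`, `abc ≠ 0`, `gcd(a, c) = 1`) with `a` and `c` odd (then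
`b` is odd as well, `odd_b_of_denes`, so `abc` is odd; conversely `abc` odd means `c` odd, `a, b`
being odd in any primitive solution), the conductor of the Frey curve `Y² = X(X − aᵖ)(X − 2cᵖ)`
is exactly `2⁵ rad(abc)`: the exponent at `2` is `f₂ = 5` (`conductorExponent_freyCurve_denes_two`,
Tate's algorithm, type `III`) and at an odd prime `ℓ` it is `1` or `0` according as `ℓ ∣ abc`
(`factorization_conductorNorm_freyCurve_denes`). No sign normalisation of `a` is needed in this
case. [cite: DarmonMerel1997, Prop. 1.1 (1)] -/
theorem conductorNorm_freyCurve_denes_of_odd (hp : 1 ≤ p) (h : a ^ p + b ^ p = 2 * c ^ p)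
    (h0 : a * b * c ≠ 0) (hac : IsCoprime a c) (ha : Odd a) (hc : Odd c) :
    (freyCurve (a ^ p) (-(2 * c ^ p))).conductorNorm ℤ = 2 ^ 5 * radical (a * b * c).natAbs := by
  haveI := isElliptic_freyCurve_denes h h0
  set N := (freyCurve (a ^ p) (-(2 * c ^ p))).conductorNorm ℤ with hN
  have hN0 : N ≠ 0 := (conductorNorm_pos_holds _).ne'
  have hn : (a * b * c).natAbs ≠ 0 := Int.natAbs_ne_zero.mpr h0
  have hb : Odd b := odd_b_of_denes hp h ha
  have habc : ¬ 2 ∣ (a * b * c).natAbs := by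
    rw [← Int.natCast_dvd, Nat.cast_ofNat]
    exact not_two_dvd_of_odd ((ha.mul hb).mul hc)
  refine Nat.eq_of_factorization_eq hN0 (mul_ne_zero (by positivity) radical_ne_zero) fun q ↦ ?_
  by_cases hq : q.Prime
  swap
  · simp [Nat.factorization_eq_zero_of_not_prime _ hq]
  rw [Nat.factorization_mul (by positivity) radical_ne_zero, Finsupp.add_apply,
    factorization_radical_apply hn hq, Nat.Prime.factorization_pow Nat.prime_two,
    Finsupp.single_apply]
  by_cases h2 : q = 2
  · subst h2
    rw [if_pos rfl, if_neg habc, add_zero, hN,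
      show (2 : ℕ) = ((⟨2, Nat.prime_two⟩ : Nat.Primes) : ℕ) from rfl,
      factorization_conductorNorm_primesEquiv_symm]
    exact conductorExponent_freyCurve_denes_two h h0 ha hc _
      (Literature.NumberTheory.EllipticCurves.Rat.natGenerator_primesEquiv_symm _)
  · rw [if_neg (Ne.symm h2), zero_add, hN,
      factorization_conductorNorm_freyCurve_denes hp h h0 hac ha hq h2]
    by_cases hd : (q : ℤ) ∣ a * b * c
    · rw [if_pos hd, if_pos (Int.natCast_dvd.mp hd)]
    · rw [if_neg hd, if_neg (fun hd' ↦ hd (Int.natCast_dvd.mpr hd'))]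

/-- **Darmon–Merel 1997, Prop. 1.1 (1), complete: "`N = rad(abc)` if `abc` is even, and
`N = 2⁵ rad(abc)` if `abc` is odd"**, for a solution of `aᵖ + bᵖ = 2cᵖ` (`p ≥ 4` odd, `abc ≠ 0`,
`gcd(a, c) = 1`) normalised as in the source by `a ≡ −1 (mod 4)` (§1, p. 5: "By multiplying
`(a, b, c)` by `−1` if necessary, assume that `a ≡ −1 (mod 4)`"); `abc` is even iff `c` is, `a`
and `b` being odd. The even case is `conductorNorm_freyCurve_denes_of_even`
(`DenesEquationFreyCurveProofs`, where the normalisation is used), the odd case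
`conductorNorm_freyCurve_denes_of_odd`. [cite: DarmonMerel1997, Prop. 1.1 (1)] -/
theorem conductorNorm_freyCurve_denes (hp : 4 ≤ p) (hpo : Odd p) (h : a ^ p + b ^ p = 2 * c ^ p)
    (h0 : a * b * c ≠ 0) (hac : IsCoprime a c) (ha4 : a ≡ -1 [ZMOD 4]) :
    (freyCurve (a ^ p) (-(2 * c ^ p))).conductorNorm ℤ =
      if 2 ∣ c then radical (a * b * c).natAbs else 2 ^ 5 * radical (a * b * c).natAbs := by
  split_ifs with hc2
  · exact conductorNorm_freyCurve_denes_of_even hp hpo h h0 hac ha4 hc2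
  · exact conductorNorm_freyCurve_denes_of_odd (by omega) h h0 hac (odd_of_modEq_neg_one_four ha4)
      (Int.not_even_iff_odd.mp fun he ↦ hc2 he.two_dvd)

end Denes

end Literature.NumberTheory.DiophantineGeometry
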